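import Literature.MathematicalPhysics.KineticTheory.LangevinChainDynkin
import Mathlib.MeasureTheory.Integral.MeanInequalities
import HarnessLib

/-!
# Towards CEHR Theorem 5.1 / Remark 5.2 (H2) for the pinned chain: the probabilistic assembly

Trunk T-KINETIC (Literature/MathematicalPhysics/KineticTheory). Provefact unit for the named fact
`CuneoEckmannHairerReyBellet2018_H2` (`LangevinChainDynkin.lean`): Cuneo–Eckmann–Hairer–Rey-Bellet,
*Non-equilibrium steady states for networks of oscillators*, EJP 23 (2018) no. 55, §5 (arXiv
pagination pp. 11–16), Theorem 5.1 ("there is a constant `C₁ > 0` such that for all `z₀` such that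
`H(z₀)` is large enough, `E_{z₀} e^{θH(z_{t*}) - θH(z₀)} ≤ e^{-C₁H(z₀)}`") and Remark 5.2 (hence
`E_z e^{θH(z_{t*})} ≤ κ e^{θH(z)} + c 1_K(z)`).

The printed proof (§5, p. 12) runs through Itô's formula, the Doléans-Dade exponential
supermartingale (Lemma 5.5), stopping times and the strong Markov property (Cor. 5.4, Lemma 5.6).
For the transition kernels CONSTRUCTED in the tree (`OscillatorChain.transitionKernel`, the law of
the pathwise solution map `solMap` under the pair of Wiener measures, `LangevinChainKernel.lean`)
we follow an Itô-free route with the same analytic heart (the high-energy dissipation estimate,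
Prop. 5.3) but an elementary probabilistic shell, proved in this file:

* `pinnedChain_H2_of_decay` — **Remark 5.2**: if for `H(z) ≥ E₁` one has
  `P_{t*} e^{θH}(z) ≤ e^{θH(z)}/2`, then H2 holds with `κ = 1/2`, `K = {H ≤ E₁}` (compact,
  `LangevinChainLyapunov.lean`) and `c = e^{θγ(T_L+T_R)t*} e^{θE₁}` (the a-priori bound (3.4),
  `LangevinChainExpBound.lean`, on `K`).
* `pinnedChain_decay_of_window` — **reduction to one short window** (in place of the iteration
  over stopping times of Cor. 5.4; cf. Remark 5.7: Carmona 2007 only shows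
  `E_{z₀} e^{θH(z_{t*}) - θH(z₀)} → 0`, which suffices for Remark 5.2): if from every `z` of high
  energy some window `w ≤ t*` achieves `P_w e^{θH}(z) ≤ κ₀ e^{θH(z)}` with
  `κ₀ e^{θγ(T_L+T_R)t*} ≤ 1/2`, then `P_{t*} e^{θH}(z) ≤ e^{θH(z)}/2` (Chapman–Kolmogorov and (3.4)
  on the remaining time `t* - w`).
* `pinnedChain_window_decay_of_pathwise` — **the window estimate from a pathwise energy drop**
  (in place of Lemma 5.5): if on the event `{sup_{s≤w}|B^{1,2}_s| ≤ a}` (`goodEvent a w`,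
  `BrownianSupTail.lean`) the solution started at `z` satisfies `θH(Φ_w(z,B)) ≤ θH(z) - D`, then
  `P_w e^{θH}(z) ≤ e^{θH(z)} (e^{-D} + e^{θγ(T_L+T_R)w} P(goodEventᶜ)^{1-1/p})`, by splitting the
  expectation, Hölder's inequality with `pθ < 1/max(T_L,T_R)` on the bad event and (3.4) at `pθ`.

The remaining (deterministic, pathwise) input — the dissipation lower bound at high energy over a
window `τ(E) → 0` (CEHR Prop. 5.3/5.14, §5.1–5.2) — is the subject of the sequel; nothing here is
left as a hypothesis structure or named fact.

## References

* N. Cuneo, J.-P. Eckmann, M. Hairer, L. Rey-Bellet, EJP 23 (2018) no. 55 (arXiv:1712.09413), §3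
  eq. (3.4), §5 Thm 5.1, Rem 5.2, Prop 5.3, Cor 5.4, Lemma 5.5, Rem 5.7.
* P. Carmona, *Existence and uniqueness of an invariant measure for a chain of oscillators in
  contact with two heat baths*, Stoch. Proc. Appl. 117 (2007) 1076–1092 (the weaker decay
  `E e^{θH(z_{t*})-θH(z₀)} → 0`).
-/

noncomputable section

open MeasureTheory ProbabilityTheory Filter Topology Set Metric
open scoped NNReal ENNReal

namespace Literature.MathematicalPhysics.KineticTheory.HeatConduction

open Literature.Probability.Process OscillatorChain

section Assembly

variable {ω₂ lam β γ : ℝ} {N : ℕ} {T_L T_R : ℝ}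
variable (hω : 0 < ω₂) (hl : 0 ≤ lam) (hβ : 0 < β) (hγ : 0 < γ) (hN : 0 < N) (hTL : 0 < T_L)
  (hTR : 0 < T_R)
include hω hl hβ hγ hN hTL hTR

/-- **Remark 5.2 of CEHR for the constructed kernels**: a uniform decay
`P_{t*} e^{θH}(z) ≤ e^{θH(z)}/2` above the energy `E₁` gives the Lyapunov condition H2 with
`κ = 1/2`, the compact `K = {H ≤ E₁}` and `c = e^{θγ(T_L+T_R)t*} e^{θE₁}` (on `K` the a-priori
bound (3.4) `P_t e^{θH} ≤ e^{θγ(T_L+T_R)t} e^{θH}` applies).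
[cite: CuneoEckmannHairerReyBellet2018, Rem 5.2] -/
theorem pinnedChain_H2_of_decay {θ : ℝ} (hθ : 0 < θ) (hθ' : θ < 1 / max T_L T_R) (tstar : ℝ≥0)
    {E₁ : ℝ}
    (hdecay : ∀ z : PhaseSpace N, E₁ ≤ (pinnedChain ω₂ lam β γ).hamiltonian N z →
      ∫⁻ y, ENNReal.ofReal (Real.exp (θ * (pinnedChain ω₂ lam β γ).hamiltonian N y))
          ∂((pinnedChain ω₂ lam β γ).transitionKernel N T_L T_R tstar z) ≤
        ENNReal.ofReal (Real.exp (θ * (pinnedChain ω₂ lam β γ).hamiltonian N z) / 2)) :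
    ∃ (κ c : ℝ) (K : Set (PhaseSpace N)), 0 < κ ∧ κ < 1 ∧ 0 < c ∧ IsCompact K ∧
      ∀ z : PhaseSpace N,
        ∫⁻ y, ENNReal.ofReal (Real.exp (θ * (pinnedChain ω₂ lam β γ).hamiltonian N y))
            ∂((pinnedChain ω₂ lam β γ).transitionKernel N T_L T_R tstar z) ≤
          ENNReal.ofReal (κ * Real.exp (θ * (pinnedChain ω₂ lam β γ).hamiltonian N z) +
            c * K.indicator 1 z) := by
  set H := (pinnedChain ω₂ lam β γ).hamiltonian N with hH
  set c := Real.exp (θ * γ * (T_L + T_R) * tstar) * Real.exp (θ * E₁) with hc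
  have hcpos : 0 < c := by positivity
  refine ⟨1 / 2, c, {x | H x ≤ E₁}, by norm_num, by norm_num, hcpos,
    pinnedChain_isCompact_setOf_hamiltonian_le hω hl hβ.le γ N E₁, fun z => ?_⟩
  have hind : 0 ≤ ({x | H x ≤ E₁} : Set (PhaseSpace N)).indicator (1 : PhaseSpace N → ℝ) z :=
    Set.indicator_nonneg (fun _ _ => zero_le_one) z
  by_cases hz : E₁ ≤ H z
  · refine (hdecay z hz).trans (ENNReal.ofReal_le_ofReal ?_)
    have : 0 ≤ c * ({x | H x ≤ E₁} : Set (PhaseSpace N)).indicator 1 z := mul_nonneg hcpos.le hind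
    linarith
  · have hzK : z ∈ ({x | H x ≤ E₁} : Set (PhaseSpace N)) := le_of_lt (not_le.1 hz)
    rw [Set.indicator_of_mem hzK, Pi.one_apply, mul_one]
    refine (lintegral_exp_mul_hamiltonian_pinnedChainSemigroup_le hω hl hβ.le hγ.le hN hTL.le hTR.le
      hTL hTR hθ hθ' tstar z).trans (ENNReal.ofReal_le_ofReal ?_)
    have h1 : Real.exp (θ * H z) ≤ Real.exp (θ * E₁) :=
      Real.exp_le_exp.2 (mul_le_mul_of_nonneg_left (le_of_lt (not_le.1 hz)) hθ.le)
    have h2 : Real.exp (θ * γ * (T_L + T_R) * tstar) * Real.exp (θ * H z) ≤ c :=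
      mul_le_mul_of_nonneg_left h1 (Real.exp_pos _).le
    have h3 : 0 ≤ 1 / 2 * Real.exp (θ * H z) := by positivity
    linarith

/-- **Reduction of the decay over `[0, t*]` to one window `w ≤ t*`** (in place of CEHR Cor. 5.4):
if from every `z` with `H(z) ≥ E₁` some window `w ≤ t*` has `P_w e^{θH}(z) ≤ κ₀ e^{θH(z)}` and
`κ₀ e^{θγ(T_L+T_R)t*} ≤ 1/2`, then `P_{t*} e^{θH}(z) ≤ e^{θH(z)}/2` for `H(z) ≥ E₁`:
`P_{t*} = P_{t*-w} ∘ P_w` (Chapman–Kolmogorov) and `P_{t*-w} e^{θH} ≤ e^{θγ(T_L+T_R)(t*-w)} e^{θH}`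
((3.4)). [cite: CuneoEckmannHairerReyBellet2018, Cor 5.4 and Rem 5.7] -/
theorem pinnedChain_decay_of_window {θ : ℝ} (hθ : 0 < θ) (hθ' : θ < 1 / max T_L T_R) (tstar : ℝ≥0)
    {E₁ κ₀ : ℝ} (hκ : κ₀ * Real.exp (θ * γ * (T_L + T_R) * tstar) ≤ 1 / 2)
    (hwin : ∀ z : PhaseSpace N, E₁ ≤ (pinnedChain ω₂ lam β γ).hamiltonian N z →
      ∃ w : ℝ≥0, w ≤ tstar ∧
        ∫⁻ y, ENNReal.ofReal (Real.exp (θ * (pinnedChain ω₂ lam β γ).hamiltonian N y))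
            ∂((pinnedChain ω₂ lam β γ).transitionKernel N T_L T_R w z) ≤
          ENNReal.ofReal (κ₀ * Real.exp (θ * (pinnedChain ω₂ lam β γ).hamiltonian N z)))
    (z : PhaseSpace N) (hz : E₁ ≤ (pinnedChain ω₂ lam β γ).hamiltonian N z) :
    ∫⁻ y, ENNReal.ofReal (Real.exp (θ * (pinnedChain ω₂ lam β γ).hamiltonian N y))
        ∂((pinnedChain ω₂ lam β γ).transitionKernel N T_L T_R tstar z) ≤
      ENNReal.ofReal (Real.exp (θ * (pinnedChain ω₂ lam β γ).hamiltonian N z) / 2) := by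
  set P := pinnedChain ω₂ lam β γ with hP
  set H := P.hamiltonian N with hH
  set κ := P.transitionKernel N T_L T_R with hκ'
  obtain ⟨w, hw, hb⟩ := hwin z hz
  set s : ℝ≥0 := tstar - w with hs
  have hts : tstar = w + s := (add_tsub_cancel_of_le hw).symm
  have hsle : (s : ℝ) ≤ tstar := by
    have : s ≤ tstar := tsub_le_self
    exact_mod_cast this
  have hVm : Measurable fun y : PhaseSpace N => ENNReal.ofReal (Real.exp (θ * H y)) :=
    ENNReal.measurable_ofReal.comp (Real.measurable_exp.comp
      (measurable_const.mul (pinnedChain_continuous_hamiltonian ω₂ lam β γ N).measurable))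
  -- Chapman–Kolmogorov
  have e1 : ∫⁻ y, ENNReal.ofReal (Real.exp (θ * H y)) ∂(κ tstar z) =
      ∫⁻ y, ∫⁻ y', ENNReal.ofReal (Real.exp (θ * H y')) ∂(κ s y) ∂(κ w z) := by
    rw [hts, hκ', pinnedChain_transitionKernel_add hω hl hβ.le hγ.le N T_L T_R w s]
    exact Kernel.lintegral_comp _ _ _ hVm
  -- (3.4) on the remaining time `s = t* - w`
  have e2 : ∀ y, ∫⁻ y', ENNReal.ofReal (Real.exp (θ * H y')) ∂(κ s y) ≤
      ENNReal.ofReal (Real.exp (θ * γ * (T_L + T_R) * tstar)) * ENNReal.ofReal (Real.exp (θ * H y)) := by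
    intro y
    refine (lintegral_exp_mul_hamiltonian_pinnedChainSemigroup_le hω hl hβ.le hγ.le hN hTL.le hTR.le
      hTL hTR hθ hθ' s y).trans ?_
    rw [← ENNReal.ofReal_mul (Real.exp_pos _).le]
    refine ENNReal.ofReal_le_ofReal (mul_le_mul_of_nonneg_right ?_ (Real.exp_pos _).le)
    refine Real.exp_le_exp.2 (mul_le_mul_of_nonneg_left hsle ?_)
    have := hγ.le; have := hTL.le; have := hTR.le
    positivity
  calc ∫⁻ y, ENNReal.ofReal (Real.exp (θ * H y)) ∂(κ tstar z)
      = ∫⁻ y, ∫⁻ y', ENNReal.ofReal (Real.exp (θ * H y')) ∂(κ s y) ∂(κ w z) := e1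
    _ ≤ ∫⁻ y, ENNReal.ofReal (Real.exp (θ * γ * (T_L + T_R) * tstar)) *
          ENNReal.ofReal (Real.exp (θ * H y)) ∂(κ w z) := lintegral_mono fun y => e2 y
    _ = ENNReal.ofReal (Real.exp (θ * γ * (T_L + T_R) * tstar)) *
          ∫⁻ y, ENNReal.ofReal (Real.exp (θ * H y)) ∂(κ w z) := lintegral_const_mul _ hVm
    _ ≤ ENNReal.ofReal (Real.exp (θ * γ * (T_L + T_R) * tstar)) *
          ENNReal.ofReal (κ₀ * Real.exp (θ * H z)) := by gcongr
    _ = ENNReal.ofReal (κ₀ * Real.exp (θ * γ * (T_L + T_R) * tstar) * Real.exp (θ * H z)) := by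
        rw [← ENNReal.ofReal_mul (Real.exp_pos _).le]
        ring_nf
    _ ≤ ENNReal.ofReal (Real.exp (θ * H z) / 2) := by
        refine ENNReal.ofReal_le_ofReal ?_
        have h1 := mul_le_mul_of_nonneg_right hκ (Real.exp_pos (θ * H z)).le
        linarith

/-- **The window estimate from a pathwise energy drop** (in place of CEHR Lemma 5.5, which uses
Itô's formula and the Doléans-Dade supermartingale): if on the event
`{sup_{s≤w}|B¹_s| ≤ a, sup_{s≤w}|B²_s| ≤ a}` of the pair of Brownian motions the pathwise solution
started at `z` loses at least `D/θ` of energy by time `w`, then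
`P_w e^{θH}(z) ≤ e^{θH(z)} (e^{-D} + e^{θγ(T_L+T_R)w} P(bad)^{1-1/p})` for any `p > 1` with
`pθ < 1/max(T_L,T_R)`: the expectation is split according to the event; on the bad event Hölder's
inequality and the a-priori bound (3.4) at `pθ` (`(P_w e^{pθH}(z))^{1/p} ≤ e^{θγ(T_L+T_R)w} e^{θH(z)}`)
are used. [cite: CuneoEckmannHairerReyBellet2018, Lemma 5.5 and §3 eq. (3.4)] -/
theorem pinnedChain_window_decay_of_pathwise {θ : ℝ} (hθ : 0 < θ) {p : ℝ} (hp : 1 < p)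
    (hpθ : p * θ < 1 / max T_L T_R) (w : ℝ≥0) (a D : ℝ) (z : PhaseSpace N)
    (hgood : ∀ ω ∈ goodEvent a w,
      θ * (pinnedChain ω₂ lam β γ).hamiltonian N
          ((pinnedChain ω₂ lam β γ).solMap N T_L T_R w z (pairPath ω)) ≤
        θ * (pinnedChain ω₂ lam β γ).hamiltonian N z - D) :
    ∫⁻ y, ENNReal.ofReal (Real.exp (θ * (pinnedChain ω₂ lam β γ).hamiltonian N y))
        ∂((pinnedChain ω₂ lam β γ).transitionKernel N T_L T_R w z) ≤
      ENNReal.ofReal (Real.exp (θ * (pinnedChain ω₂ lam β γ).hamiltonian N z)) *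
        (ENNReal.ofReal (Real.exp (-D)) +
          ENNReal.ofReal (Real.exp (θ * γ * (T_L + T_R) * w)) *
            (wienerPair (goodEvent a w)ᶜ) ^ (1 - p⁻¹)) := by
  set P := pinnedChain ω₂ lam β γ with hP
  set H := P.hamiltonian N with hH
  set κ := P.transitionKernel N T_L T_R with hκ'
  set Φ : WienerPair → PhaseSpace N := fun ω => P.solMap N T_L T_R w z (pairPath ω) with hΦ
  set G := goodEvent a w with hG
  have hGm : MeasurableSet G := measurableSet_goodEvent a w
  have hp0 : (0 : ℝ) < p := by linarith
  have hθp : 0 < p * θ := mul_pos hp0 hθ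
  have hVm : ∀ θ' : ℝ, Measurable fun y : PhaseSpace N => ENNReal.ofReal (Real.exp (θ' * H y)) :=
    fun θ' => ENNReal.measurable_ofReal.comp (Real.measurable_exp.comp
      (measurable_const.mul (pinnedChain_continuous_hamiltonian ω₂ lam β γ N).measurable))
  have hΦm : Measurable Φ :=
    pinnedChain_measurable_solMap_pairPath_right hω hl hβ.le hγ.le N T_L T_R w z
  set f : WienerPair → ℝ≥0∞ := fun ω => ENNReal.ofReal (Real.exp (θ * H (Φ ω))) with hf
  have hfm : Measurable f := (hVm θ).comp hΦm
  -- pathwise representation of `P_w e^{θH}(z)`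
  have e0 : ∫⁻ y, ENNReal.ofReal (Real.exp (θ * H y)) ∂(κ w z) = ∫⁻ ω, f ω ∂wienerPair :=
    pinnedChain_lintegral_transitionKernel hω hl hβ.le hγ.le N T_L T_R w z (hVm θ)
  -- the good event: the pathwise energy drop
  have e1 : ∫⁻ ω in G, f ω ∂wienerPair ≤
      ENNReal.ofReal (Real.exp (θ * H z)) * ENNReal.ofReal (Real.exp (-D)) := by
    calc ∫⁻ ω in G, f ω ∂wienerPair
        ≤ ∫⁻ _ in G, ENNReal.ofReal (Real.exp (θ * H z)) * ENNReal.ofReal (Real.exp (-D))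
            ∂wienerPair := by
          refine setLIntegral_mono' hGm fun ω hω => ?_
          show ENNReal.ofReal (Real.exp (θ * H (Φ ω))) ≤ _
          rw [← ENNReal.ofReal_mul (Real.exp_pos _).le, ← Real.exp_add]
          exact ENNReal.ofReal_le_ofReal (Real.exp_le_exp.2 (by linarith [hgood ω hω]))
      _ = ENNReal.ofReal (Real.exp (θ * H z)) * ENNReal.ofReal (Real.exp (-D)) * wienerPair G :=
          setLIntegral_const _ _
      _ ≤ ENNReal.ofReal (Real.exp (θ * H z)) * ENNReal.ofReal (Real.exp (-D)) * 1 := by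
          gcongr
          exact prob_le_one
      _ = _ := mul_one _
  -- the bad event: Hölder with exponents `p`, `p/(p-1)` and (3.4) at `pθ`
  have e2 : ∫⁻ ω in Gᶜ, f ω ∂wienerPair ≤
      ENNReal.ofReal (Real.exp (θ * H z)) * (ENNReal.ofReal (Real.exp (θ * γ * (T_L + T_R) * w)) *
        (wienerPair Gᶜ) ^ (1 - p⁻¹)) := by
    have hpq : p.HolderConjugate (Real.conjExponent p) := Real.HolderConjugate.conjExponent hp
    set g : WienerPair → ℝ≥0∞ := Gᶜ.indicator 1 with hg
    have hgm : Measurable g := measurable_one.indicator hGm.compl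
    have e21 : ∫⁻ ω in Gᶜ, f ω ∂wienerPair = ∫⁻ ω, (f * g) ω ∂wienerPair := by
      rw [← lintegral_indicator hGm.compl]
      refine lintegral_congr fun ω => ?_
      by_cases hω : ω ∈ Gᶜ
      · rw [Set.indicator_of_mem hω, Pi.mul_apply, hg, Set.indicator_of_mem hω, Pi.one_apply, mul_one]
      · rw [Set.indicator_of_notMem hω, Pi.mul_apply, hg, Set.indicator_of_notMem hω, mul_zero]
    have e22 := ENNReal.lintegral_mul_le_Lp_mul_Lq wienerPair hpq hfm.aemeasurable hgm.aemeasurable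
    have e23 : ∫⁻ ω, f ω ^ p ∂wienerPair ≤
        ENNReal.ofReal (Real.exp (p * θ * γ * (T_L + T_R) * w) * Real.exp (p * θ * H z)) := by
      have h1 : ∀ ω, f ω ^ p = ENNReal.ofReal (Real.exp (p * θ * H (Φ ω))) := fun ω => by
        show ENNReal.ofReal (Real.exp (θ * H (Φ ω))) ^ p = _
        rw [ENNReal.ofReal_rpow_of_pos (Real.exp_pos _), ← Real.exp_mul]
        congr 2
        ring
      simp_rw [h1]
      rw [← pinnedChain_lintegral_transitionKernel hω hl hβ.le hγ.le N T_L T_R w z (hVm (p * θ))]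
      exact lintegral_exp_mul_hamiltonian_pinnedChainSemigroup_le hω hl hβ.le hγ.le hN hTL.le hTR.le
        hTL hTR hθp hpθ w z
    have e24 : (∫⁻ ω, f ω ^ p ∂wienerPair) ^ (1 / p) ≤
        ENNReal.ofReal (Real.exp (θ * γ * (T_L + T_R) * w) * Real.exp (θ * H z)) := by
      refine (ENNReal.rpow_le_rpow e23 (by positivity)).trans (le_of_eq ?_)
      have h2 : (Real.exp (p * θ * γ * (T_L + T_R) * w) * Real.exp (p * θ * H z)) ^ (1 / p) =
          Real.exp (θ * γ * (T_L + T_R) * w) * Real.exp (θ * H z) := by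
        rw [← Real.exp_add, ← Real.exp_add, ← Real.exp_mul]
        congr 1
        field_simp
      rw [ENNReal.ofReal_rpow_of_nonneg (by positivity) (by positivity), h2]
    have e25 : ∫⁻ ω, g ω ^ Real.conjExponent p ∂wienerPair = wienerPair Gᶜ := by
      have hq : 0 < Real.conjExponent p := hpq.symm.pos
      have h1 : ∀ ω, g ω ^ Real.conjExponent p = g ω := fun ω => by
        by_cases hω : ω ∈ Gᶜ
        · rw [hg, Set.indicator_of_mem hω, Pi.one_apply, ENNReal.one_rpow]
        · rw [hg, Set.indicator_of_notMem hω, ENNReal.zero_rpow_of_pos hq]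
      simp_rw [h1, hg]
      exact lintegral_indicator_one hGm.compl
    have e26 : 1 / Real.conjExponent p = 1 - p⁻¹ := by
      simp only [Real.conjExponent]
      have : p - 1 ≠ 0 := by linarith
      field_simp
    calc ∫⁻ ω in Gᶜ, f ω ∂wienerPair = ∫⁻ ω, (f * g) ω ∂wienerPair := e21
      _ ≤ (∫⁻ ω, f ω ^ p ∂wienerPair) ^ (1 / p) *
            (∫⁻ ω, g ω ^ Real.conjExponent p ∂wienerPair) ^ (1 / Real.conjExponent p) := e22
      _ ≤ ENNReal.ofReal (Real.exp (θ * γ * (T_L + T_R) * w) * Real.exp (θ * H z)) *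
            (wienerPair Gᶜ) ^ (1 - p⁻¹) := by
          rw [e25, e26]
          gcongr
      _ = _ := by
          rw [ENNReal.ofReal_mul (Real.exp_pos _).le]
          ring
  rw [e0, ← lintegral_add_compl f hGm, mul_add]
  exact add_le_add e1 e2

end Assembly

end Literature.MathematicalPhysics.KineticTheory.HeatConduction
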